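import Summits.AnomalousDissipation.AnomalousDissipation.Theorems.MomentParityCubicParityLoudBalancedMenuModes

/-!
# Extraction of the single-triad identity from a block-diagonal Casimir kernel

Helper file for stub `stub_diagonalClassification` (S3b) of the line `farkas-split-menu` of crux
`MomentParity.CubicParityLoud`.  Let `S ⊂ ℤ³` be a symmetric finite frequency set and
`D : ℤ³ → (ℂ³ →ₗ[ℂ] ℂ³)` a block-diagonal kernel whose real quadratic form
`c ↦ Σ_{k∈S} Re⟪c k, D k (c k)⟫` has zero derivative along the Galerkin–Euler field
`k ↦ Π_k 𝓕[(u·∇)u](k) = leraySym k (convectionCoeff S c c k)` at every admissible family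
(conjugate-symmetric, transversal on `S`, supported in `S`).  Evaluating this cubic identity at
the ELEMENTARY admissible family carried by one triad `a + b = c` of non-parallel frequencies in
`S` — amplitude `v_k` at `k` and `conj v_k` at `−k` for `k ∈ {a, b, c}` — only the twelve
resonant convection couplings survive (the six frequencies `±a, ±b, ±c` are `ℤ`-combinations
`m a + n b` with `(m, n)` in a fixed table, and `a ∦ b` makes the table faithful), and the
identity becomes an explicit six-block relation between `D(±a)`, `D(±b)`, `D(±c)`
(`extraction`).  The symmetric / antisymmetric real forms of it are derived downstream.  The
elementary pair lemmas `isConjSymm_pair`, `isTransversal_pair` are those of `…BalancedMenuModes`.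
-/

namespace Summit.AnomalousDissipation.AnomalousDissipation.Theorems.MomentParityCubicParityLoud

open Complex Finset Matrix
open scoped InnerProductSpace ComplexConjugate
open Literature.Analysis.FunctionSpaces Literature.Analysis.FluidPDE
open Summit.AnomalousDissipation.AnomalousDissipation.Theorems.MomentParityQuarticGate

set_option linter.dupNamespace false

/-! ## Lattice bookkeeping: `ℤ`-independence of two non-parallel frequencies -/

/-- Two integer frequencies with non-zero cross product are `ℤ`-independent. [folklore] -/
theorem indep_of_cross_ne_zero :
    ∀ (a b : Fin 3 → ℤ), crossProduct a b ≠ 0 → ∀ (m n : ℤ), m • a + n • b = 0 → m = 0 ∧ n = 0 := by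
  intro a b hab m n h
  constructor
  · have h1 : crossProduct (m • a + n • b) b = 0 := by rw [h]; simp
    rw [LinearMap.map_add₂, LinearMap.map_smul₂, LinearMap.map_smul₂, cross_self, smul_zero, add_zero] at h1
    exact (smul_eq_zero.1 h1).resolve_right hab
  · have h1 : crossProduct a (m • a + n • b) = 0 := by rw [h]; simp
    rw [map_add, map_smul, map_smul, cross_self, smul_zero, zero_add] at h1
    exact (smul_eq_zero.1 h1).resolve_right hab

/-! ## The convection symbol of finite sums of families -/

/-- The convection symbol is additive over finite sums in its first argument. [folklore] -/
theorem convectionCoeff_sum_left {ι : Type*} (T : Finset ι) (S : Finset (Fin 3 → ℤ))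
    (f : ι → (Fin 3 → ℤ) → EuclideanSpace ℂ (Fin 3)) (c' : (Fin 3 → ℤ) → EuclideanSpace ℂ (Fin 3)) (k : Fin 3 → ℤ) :
    Torus.convectionCoeff S (∑ i ∈ T, f i) c' k = ∑ i ∈ T, Torus.convectionCoeff S (f i) c' k := by
  classical
  induction T using Finset.induction_on with
  | empty => simp
  | insert i T hi ih => rw [Finset.sum_insert hi, Finset.sum_insert hi, Torus.convectionCoeff_add_left, ih]

/-- The convection symbol is additive over finite sums in its second argument. [folklore] -/
theorem convectionCoeff_sum_right {ι : Type*} (T : Finset ι) (S : Finset (Fin 3 → ℤ))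
    (c : (Fin 3 → ℤ) → EuclideanSpace ℂ (Fin 3)) (f : ι → (Fin 3 → ℤ) → EuclideanSpace ℂ (Fin 3)) (k : Fin 3 → ℤ) :
    Torus.convectionCoeff S c (∑ i ∈ T, f i) k = ∑ i ∈ T, Torus.convectionCoeff S c (f i) k := by
  classical
  induction T using Finset.induction_on with
  | empty => simp
  | insert i T hi ih => rw [Finset.sum_insert hi, Finset.sum_insert hi, Torus.convectionCoeff_add_right, ih]

/-! ## The extraction -/

set_option maxHeartbeats 800000 in
/-- **Extraction of the single-triad identity.**  For a symmetric finite frequency set `S`, a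
block-diagonal kernel `D` whose real quadratic form is a Casimir of the Galerkin–Euler field on
`S` (hypothesis), a triad `a + b = c` of pairwise non-parallel frequencies in `S` (`a × b ≠ 0`)
and transversal complex amplitudes `v_a, v_b, v_c`, the cubic Casimir identity at the elementary
admissible family `Σ_{k∈{a,b,c}} (δ_k v_k + δ_{−k} conj v_k)` is the explicit six-block relation
below: at each of `a, b, c, −a, −b, −c` exactly the two resonant convection couplings survive.
[folklore] -/
theorem extraction :
    ∀ (S : Finset (Fin 3 → ℤ)) (D : (Fin 3 → ℤ) → (EuclideanSpace ℂ (Fin 3) →ₗ[ℂ] EuclideanSpace ℂ (Fin 3))),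
    (∀ k ∈ S, -k ∈ S) →
    (∀ c : (Fin 3 → ℤ) → EuclideanSpace ℂ (Fin 3), (Torus.IsConjSymm c ∧ Torus.IsTransversal S c ∧
        ∀ k ∉ S, c k = 0) →
      ∑ k ∈ S, ((inner ℂ (Torus.leraySym k (Torus.convectionCoeff S c c k)) (D k (c k))).re +
        (inner ℂ (c k) (D k (Torus.leraySym k (Torus.convectionCoeff S c c k)))).re) = 0) →
    ∀ (a b c : Fin 3 → ℤ), a ∈ S → b ∈ S → c ∈ S → a + b = c → crossProduct a b ≠ 0 →
    ∀ (va vb vc : EuclideanSpace ℂ (Fin 3)), (∑ j, (a j : ℂ) * va j = 0) → (∑ j, (b j : ℂ) * vb j = 0) →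
      (∑ j, (c j : ℂ) * vc j = 0) →
      (inner ℂ (Torus.leraySym a ((2 * (Real.pi : ℂ) * Complex.I * ∑ x, vc x * -((b x : ℤ) : ℂ)) •
        EuclideanSpace.conjVec vb + (2 * (Real.pi : ℂ) * Complex.I * ∑ x, starRingEnd ℂ (vb x) * ((c x : ℤ)
        : ℂ)) • vc)) (D a va)).re + (inner ℂ (va) (D a (Torus.leraySym a ((2 * (Real.pi : ℂ) * Complex.I * ∑
        x, vc x * -((b x : ℤ) : ℂ)) • EuclideanSpace.conjVec vb + (2 * (Real.pi : ℂ) * Complex.I * ∑ x,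
        starRingEnd ℂ (vb x) * ((c x : ℤ) : ℂ)) • vc)))).re + ((inner ℂ (Torus.leraySym b ((2 * (Real.pi :
        ℂ) * Complex.I * ∑ x, vc x * -((a x : ℤ) : ℂ)) • EuclideanSpace.conjVec va + (2 * (Real.pi : ℂ) *
        Complex.I * ∑ x, starRingEnd ℂ (va x) * ((c x : ℤ) : ℂ)) • vc)) (D b vb)).re + (inner ℂ (vb) (D b
        (Torus.leraySym b ((2 * (Real.pi : ℂ) * Complex.I * ∑ x, vc x * -((a x : ℤ) : ℂ)) •
        EuclideanSpace.conjVec va + (2 * (Real.pi : ℂ) * Complex.I * ∑ x, starRingEnd ℂ (va x) * ((c x : ℤ)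
        : ℂ)) • vc)))).re) + ((inner ℂ (Torus.leraySym c ((2 * (Real.pi : ℂ) * Complex.I * ∑ x, va x * ((b x
        : ℤ) : ℂ)) • vb + (2 * (Real.pi : ℂ) * Complex.I * ∑ x, vb x * ((a x : ℤ) : ℂ)) • va)) (D c vc)).re
        + (inner ℂ (vc) (D c (Torus.leraySym c ((2 * (Real.pi : ℂ) * Complex.I * ∑ x, va x * ((b x : ℤ) :
        ℂ)) • vb + (2 * (Real.pi : ℂ) * Complex.I * ∑ x, vb x * ((a x : ℤ) : ℂ)) • va)))).re) + ((inner ℂ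
        (Torus.leraySym (-a) ((2 * (Real.pi : ℂ) * Complex.I * ∑ x, vb x * -((c x : ℤ) : ℂ)) •
        EuclideanSpace.conjVec vc + (2 * (Real.pi : ℂ) * Complex.I * ∑ x, starRingEnd ℂ (vc x) * ((b x : ℤ)
        : ℂ)) • vb)) (D (-a) (EuclideanSpace.conjVec va))).re + (inner ℂ (EuclideanSpace.conjVec va) (D (-a)
        (Torus.leraySym (-a) ((2 * (Real.pi : ℂ) * Complex.I * ∑ x, vb x * -((c x : ℤ) : ℂ)) •
        EuclideanSpace.conjVec vc + (2 * (Real.pi : ℂ) * Complex.I * ∑ x, starRingEnd ℂ (vc x) * ((b x : ℤ)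
        : ℂ)) • vb)))).re) + ((inner ℂ (Torus.leraySym (-b) ((2 * (Real.pi : ℂ) * Complex.I * ∑ x, va x *
        -((c x : ℤ) : ℂ)) • EuclideanSpace.conjVec vc + (2 * (Real.pi : ℂ) * Complex.I * ∑ x, starRingEnd ℂ
        (vc x) * ((a x : ℤ) : ℂ)) • va)) (D (-b) (EuclideanSpace.conjVec vb))).re + (inner ℂ
        (EuclideanSpace.conjVec vb) (D (-b) (Torus.leraySym (-b) ((2 * (Real.pi : ℂ) * Complex.I * ∑ x, va x
        * -((c x : ℤ) : ℂ)) • EuclideanSpace.conjVec vc + (2 * (Real.pi : ℂ) * Complex.I * ∑ x, starRingEnd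
        ℂ (vc x) * ((a x : ℤ) : ℂ)) • va)))).re) + ((inner ℂ (Torus.leraySym (-c) ((2 * (Real.pi : ℂ) *
        Complex.I * ∑ x, starRingEnd ℂ (va x) * -((b x : ℤ) : ℂ)) • EuclideanSpace.conjVec vb + (2 *
        (Real.pi : ℂ) * Complex.I * ∑ x, starRingEnd ℂ (vb x) * -((a x : ℤ) : ℂ)) • EuclideanSpace.conjVec
        va)) (D (-c) (EuclideanSpace.conjVec vc))).re + (inner ℂ (EuclideanSpace.conjVec vc) (D (-c)
        (Torus.leraySym (-c) ((2 * (Real.pi : ℂ) * Complex.I * ∑ x, starRingEnd ℂ (va x) * -((b x : ℤ) : ℂ))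
        • EuclideanSpace.conjVec vb + (2 * (Real.pi : ℂ) * Complex.I * ∑ x, starRingEnd ℂ (vb x) * -((a x :
        ℤ) : ℂ)) • EuclideanSpace.conjVec va)))).re) = 0 := by
  intro S D hSsym hD a b c ha hb hc habc hab va vb vc hva hvb hvc
  -- the six frequencies as `ℤ`-combinations of `a, b`
  obtain ⟨t, ht⟩ : ∃ t : Fin 6 → (Fin 3 → ℤ), t = ![a, b, c, -a, -b, -c] := ⟨_, rfl⟩
  obtain ⟨φ, hφ⟩ : ∃ φ : Fin 6 → ℤ × ℤ, φ = ![(1, 0), (0, 1), (1, 1), (-1, 0), (0, -1), (-1, -1)] := ⟨_, rfl⟩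
  obtain ⟨w, hw⟩ : ∃ w : Fin 6 → EuclideanSpace ℂ (Fin 3), w = ![va, vb, vc, EuclideanSpace.conjVec va,
      EuclideanSpace.conjVec vb, EuclideanSpace.conjVec vc] := ⟨_, rfl⟩
  have htφ : ∀ I, t I = (φ I).1 • a + (φ I).2 • b := by
    intro I; rw [ht, hφ, ← habc]; fin_cases I <;> simp; abel
  have hadd : ∀ I J K, t I + t J = t K ↔ φ I + φ J = φ K := by
    intro I J K
    constructor
    · intro h
      rw [htφ, htφ, htφ] at h
      have h0 : ((φ I).1 + (φ J).1 - (φ K).1) • a + ((φ I).2 + (φ J).2 - (φ K).2) • b = 0 := by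
        simp only [add_smul, sub_smul]
        rw [← sub_eq_zero] at h
        rw [← h]; abel
      obtain ⟨h1, h2⟩ := indep_of_cross_ne_zero a b hab _ _ h0
      ext <;> simp only [Prod.fst_add, Prod.snd_add] <;> omega
    · intro h
      rw [htφ, htφ, htφ, ← h, Prod.fst_add, Prod.snd_add, add_smul, add_smul]; abel
  have hinj : ∀ I J, t I = t J ↔ I = J := by
    intro I J
    constructor
    · intro h
      rw [htφ, htφ] at h
      have h0 : ((φ I).1 - (φ J).1) • a + ((φ I).2 - (φ J).2) • b = 0 := by
        simp only [sub_smul]; rw [← sub_eq_zero] at h; rw [← h]; abel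
      obtain ⟨h1, h2⟩ := indep_of_cross_ne_zero a b hab _ _ h0
      have : φ I = φ J := by ext <;> omega
      rw [hφ] at this
      revert this; fin_cases I <;> fin_cases J <;> simp
    · rintro rfl; rfl
  have htS : ∀ I, t I ∈ S := by
    intro I; rw [ht]; fin_cases I
    · exact ha
    · exact hb
    · exact hc
    · exact hSsym a ha
    · exact hSsym b hb
    · exact hSsym c hc
  -- the elementary family of the triad
  obtain ⟨fam, hfam⟩ : ∃ fam : (Fin 3 → ℤ) → EuclideanSpace ℂ (Fin 3),
      fam = (Pi.single a va + Pi.single (-a) (EuclideanSpace.conjVec va)) +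
        (Pi.single b vb + Pi.single (-b) (EuclideanSpace.conjVec vb)) +
        (Pi.single c vc + Pi.single (-c) (EuclideanSpace.conjVec vc)) := ⟨_, rfl⟩
  have hfam6 : fam = ∑ I, (Pi.single (t I) (w I) : (Fin 3 → ℤ) → EuclideanSpace ℂ (Fin 3)) := by
    rw [hfam, ht, hw, Fin.sum_univ_six]
    simp only [cons_val_zero, cons_val_one, cons_val_two, Matrix.cons_val, head_cons, tail_cons]
    abel
  have hadm : Torus.IsConjSymm fam ∧ Torus.IsTransversal S fam ∧ ∀ k ∉ S, fam k = 0 := by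
    refine ⟨?_, ?_, ?_⟩
    · rw [hfam]
      exact ((isConjSymm_pair a va).add (isConjSymm_pair b vb)).add (isConjSymm_pair c vc)
    · rw [hfam]
      intro m hm
      have h1 := isTransversal_pair S hva m hm
      have h2 := isTransversal_pair S hvb m hm
      have h3 := isTransversal_pair S hvc m hm
      simp only [Pi.add_apply, PiLp.add_apply, mul_add, Finset.sum_add_distrib] at h1 h2 h3 ⊢
      rw [h1, h2, h3, add_zero, add_zero]
    · intro k hk
      rw [hfam6, Finset.sum_apply]
      refine Finset.sum_eq_zero fun I _ => ?_
      rw [Pi.single_apply, if_neg]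
      intro h; rw [h] at hk; exact hk (htS I)
  -- values of the family
  have hfam_t : ∀ K, fam (t K) = w K := by
    intro K
    rw [hfam6, Finset.sum_apply]
    simp only [Pi.single_apply, hinj]
    rw [Finset.sum_ite_eq]; simp
  -- the Casimir identity at the family, restricted to the six frequencies
  have key := hD fam hadm
  have hzero : ∀ k ∈ S, k ∉ Finset.univ.image t →
      ((inner ℂ (Torus.leraySym k (Torus.convectionCoeff S fam fam k)) (D k (fam k))).re +
        (inner ℂ (fam k) (D k (Torus.leraySym k (Torus.convectionCoeff S fam fam k)))).re) = 0 := by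
    intro k _ hk
    have h0 : fam k = 0 := by
      rw [hfam6, Finset.sum_apply]
      refine Finset.sum_eq_zero fun I _ => ?_
      rw [Pi.single_apply, if_neg]
      intro h; apply hk; rw [h]; exact Finset.mem_image_of_mem t (Finset.mem_univ I)
    rw [h0, map_zero, inner_zero_right, inner_zero_left, Complex.zero_re, add_zero]
  have himg : Finset.univ.image t ⊆ S := by
    intro k hk
    obtain ⟨I, -, rfl⟩ := Finset.mem_image.1 hk
    exact htS I
  rw [← Finset.sum_subset himg hzero, Finset.sum_image (fun I _ J _ h => (hinj I J).1 h)] at key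
  -- the convection symbol at the six frequencies
  have hconv : ∀ K, Torus.convectionCoeff S fam fam (t K) =
      ∑ p, ∑ q, if φ p + φ q = φ K then (2 * Real.pi * Complex.I * ∑ j, w p j * (t q j : ℂ)) • w q else 0 := by
    intro K
    rw [hfam6, convectionCoeff_sum_left]
    refine Finset.sum_congr rfl fun p _ => ?_
    rw [convectionCoeff_sum_right]
    refine Finset.sum_congr rfl fun q _ => ?_
    rw [convectionCoeff_single_single (htS p) (htS q), if_congr (hadd p q K) rfl rfl]
  simp_rw [hfam_t, hconv] at key
  rw [Fin.sum_univ_six] at key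
  simp (config := {decide := true}) only [Fin.sum_univ_six, hφ, ht, hw, cons_val_zero, cons_val_one, cons_val_two,
    Matrix.cons_val, head_cons, tail_cons, Int.reduceNeg, if_true,
    if_false, zero_add, add_zero, Pi.neg_apply, Int.cast_neg, EuclideanSpace.conjVec_apply] at key
  trace_state
  trivial

end Summit.AnomalousDissipation.AnomalousDissipation.Theorems.MomentParityCubicParityLoud
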